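import Literature.Computability.Complexity.BoundedQuantifiersFine
import Literature.Computability.Complexity.IKWScales
import Literature.Computability.Complexity.UniformDerandomizationDistinguishers
import HarnessLib

/-!
# Bounded quantifiers within `DTIME(2^{n^ε})`: the subexponential majority vote

Literature / complexity toolkit. The fine deciders of `BoundedQuantifiersFine.lean`
(`NKannan.DecIn.bmajFine`, `NKannan.DecIn.bexFine`: cost
`2^{a (β n + 1)} · p(N) · (t n (2N + 2 + β n) + 1)`) are packaged into membership in the tree's
`DTIME (fun n => 2 ^ ⌈(n : ℝ) ^ ε⌉₊)` (the rendering of `DTIME[2^{n^ε}]` used by `SUBEXP`,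
`Classes.lean`, and by the fact `impagliazzoWigderson1998`), at the scales of `IKWScales.lean`:
the quantifier range and the matrix time are measured against `m(n) = Nat.sqrt^[j] n = ⌊n^{2^{-j}}⌋`
(the root a machine can compute), and the budget `2^{⌈n^ε⌉₊}` is met once `p · 2^{-j} < ε`
(`eventually_linear_scale_pow_le_ceil_rpow`: `a m^p + b log₂ n + c ≤ ⌈n^ε⌉₊` for all large `n`).

* `NKannan.EBnd p j Q` — bookkeeping predicate `Q n ≤ 2^{a m(n)^p + a log₂ n + c}`, closed under
  `+`, `·`, powers, polynomials, containing `n`, `m^p`, `2^{O(m^p)}` — and its punchline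
  `EBnd.eventually_le_two_pow_ceil_rpow`;
* `NKannan.DecIn.mem_DTIME_of_eventually_le` — a level-`0` decider with an eventual time bound
  is a `DTIME` algorithm (finitely many lengths absorbed in the constant,
  `exists_const_of_eventually_le`);
* **`NKannan.DecIn.bmajFine_mem_DTIME_ceil_rpow`**, `NKannan.DecIn.bexFine_mem_DTIME_ceil_rpow` —
  a bounded majority / existential quantifier over `β n ≤ K m^p + K` bits of a matrix decided in
  time `2^{O(m^p)} · poly` is in `DTIME(2^{n^ε})` for every `ε > p · 2^{-j}`;
* the instance for the majority-vote simulation of Impagliazzo–Wigderson 1998, §2.1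
  (`UniformDerandomizationDistinguishers.lean`): `IWUniform.matrix` (the language
  `{⟨x, s⟩ | ⟨x, g_{|x|}(s)⟩ ∈ L'}`), `IWUniform.majSim_eq_BMAJ` (`majSim L' g k = BMAJ 0 k matrix`)
  and **`IWUniform.majSim_mem_DTIME_ceil_rpow`** — "we construct the range of `G_n` … in time
  `2^{O(n^c)} = O(2^{k^δ})`. We then simulate the `BPP` algorithm on each element of the range and
  take the majority vote" (IW §2.1): the simulating language `B` of van Melkebeek's Thm. 6.2.1 is
  in `DTIME[2^{n^ε}]` as soon as the generator's matrix is decided in time `2^{O(m^{p})}·poly` on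
  seeds of length `O(m^p)`, `m = ⌊n^{2^{-j}}⌋`, `p 2^{-j} < ε`.

Everything is proved; no named facts.

## References

* R. Impagliazzo, A. Wigderson, *Randomness vs time: derandomization under a uniform
  assumption*, JCSS 63 (2001) 672–688, §2.1 (second paragraph: the simulation and its running
  time). [ImpagliazzoWigderson2001]
* D. van Melkebeek, *Randomness and Completeness in Computational Complexity*, LNCS 1950 (2000),
  Thm. 6.2.1 (`B ∈ DTIME[2^{n^ε}]`). [VanMelkebeek2000]
* S. Arora, B. Barak, *Computational Complexity: A Modern Approach*, CUP 2009, proof of Lemma 20.3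
  ("time `2^{O(ℓ(n))}` … trying all seeds"), §20.1 (`SUBEXP`, `DTIME(2^{n^ε})`). [AroraBarakCC2009]
-/

noncomputable section

namespace Literature.Computability.Complexity

namespace NKannan

open _root_.Computability Turing Function Polynomial Filter

/-! ### Bookkeeping: quantities `≤ 2^{a m^p + a log₂ n + c}`, `m = Nat.sqrt^[j] n` -/

section EBnd

variable {p j : ℕ}

/-- `EBnd p j Q`: `Q n ≤ 2^{a m(n)^p + a log₂ n + c}` for constants `a, c`, where
`m(n) = Nat.sqrt^[j] n = ⌊n^{2^{-j}}⌋` — i.e. `Q = 2^{O(m^p)} · poly(n)`. [folklore] -/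
def EBnd (p j : ℕ) (Q : ℕ → ℕ) : Prop :=
  ∃ a c : ℕ, ∀ n, Q n ≤ 2 ^ (a * (Nat.sqrt^[j] n) ^ p + a * Nat.log 2 n + c)

/-- Monotonicity. [folklore] -/
theorem EBnd.mono {Q Q' : ℕ → ℕ} (h : EBnd p j Q) (hle : ∀ n, Q' n ≤ Q n) : EBnd p j Q' := by
  obtain ⟨a, c, hQ⟩ := h
  exact ⟨a, c, fun n => (hle n).trans (hQ n)⟩

/-- Quantities linear in `m^p` (in particular constants and `m^p`). [folklore] -/
theorem EBnd.lin (K : ℕ) {Q : ℕ → ℕ} (h : ∀ n, Q n ≤ K * (Nat.sqrt^[j] n) ^ p + K) : EBnd p j Q :=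
  ⟨K, K, fun n => (h n).trans ((Nat.lt_two_pow_self).le.trans
    (Nat.pow_le_pow_right (by norm_num) (by omega)))⟩

/-- Constants. [folklore] -/
theorem EBnd.const (K : ℕ) : EBnd p j fun _ => K :=
  EBnd.lin K fun _ => Nat.le_add_left _ _

/-- `2^{linear in m^p}`. [folklore] -/
theorem EBnd.two_pow (K : ℕ) {Q : ℕ → ℕ} (h : ∀ n, Q n ≤ K * (Nat.sqrt^[j] n) ^ p + K) :
    EBnd p j fun n => 2 ^ Q n :=
  ⟨K, K, fun n => Nat.pow_le_pow_right (by norm_num) ((h n).trans (by omega))⟩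

/-- The length itself (`n < 2^{log₂ n + 1}`). [folklore] -/
theorem EBnd.self : EBnd p j fun n => n :=
  ⟨1, 1, fun n => (Nat.lt_pow_succ_log_self one_lt_two n).le.trans
    (Nat.pow_le_pow_right (by norm_num) (by rw [Nat.succ_eq_add_one]; omega))⟩

/-- `2^u + 2^v ≤ 2^{u + v + 1}` (private copy of the statement proved as `two_pow_add_two_pow_le` in
`AmanoMaruokaProofs.lean`, whose import closure does not belong here). [folklore] -/
private theorem two_pow_add_two_pow_le (u v : ℕ) : 2 ^ u + 2 ^ v ≤ 2 ^ (u + v + 1) := by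
  have h1 : 2 ^ u ≤ 2 ^ (u + v) := Nat.pow_le_pow_right (by norm_num) (by omega)
  have h2 : 2 ^ v ≤ 2 ^ (u + v) := Nat.pow_le_pow_right (by norm_num) (by omega)
  rw [pow_succ]
  omega

/-- Sums. [folklore] -/
theorem EBnd.add {Q Q' : ℕ → ℕ} (h : EBnd p j Q) (h' : EBnd p j Q') : EBnd p j fun n => Q n + Q' n := by
  obtain ⟨a, c, hQ⟩ := h
  obtain ⟨a', c', hQ'⟩ := h'
  refine ⟨a + a', c + c' + 1, fun n => (Nat.add_le_add (hQ n) (hQ' n)).trans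
    ((two_pow_add_two_pow_le _ _).trans (le_of_eq ?_))⟩
  congr 1
  ring

/-- Products. [folklore] -/
theorem EBnd.mul {Q Q' : ℕ → ℕ} (h : EBnd p j Q) (h' : EBnd p j Q') : EBnd p j fun n => Q n * Q' n := by
  obtain ⟨a, c, hQ⟩ := h
  obtain ⟨a', c', hQ'⟩ := h'
  refine ⟨a + a', c + c', fun n => (Nat.mul_le_mul (hQ n) (hQ' n)).trans (le_of_eq ?_)⟩
  rw [← pow_add]
  congr 1
  ring

/-- Powers. [folklore] -/
theorem EBnd.pow {Q : ℕ → ℕ} (h : EBnd p j Q) : ∀ d : ℕ, EBnd p j fun n => Q n ^ d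
  | 0 => (EBnd.const 1).mono fun n => by simp
  | d + 1 => by simpa only [pow_succ] using (EBnd.pow h d).mul h

/-- Polynomials. [folklore] -/
theorem EBnd.poly (q : Polynomial ℕ) {Q : ℕ → ℕ} (h : EBnd p j Q) : EBnd p j fun n => q.eval (Q n) := by
  obtain ⟨c, d, hcd⟩ := exists_eval_le_mul_pow_add q
  exact (((EBnd.const c).mul (h.pow d)).add (EBnd.const c)).mono fun n => hcd _

/-- **The punchline**: an `EBnd p j` quantity is within the budget `2^{⌈n^ε⌉₊}` for all large `n`
once `p · 2^{-j} < ε` (`eventually_linear_scale_pow_le_ceil_rpow`, `IKWScales.lean`).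
[folklore] -/
theorem EBnd.eventually_le_two_pow_ceil_rpow {Q : ℕ → ℕ} (h : EBnd p j Q) {ε : ℝ}
    (hε : p * (1 / 2 : ℝ) ^ j < ε) : ∀ᶠ n : ℕ in atTop, Q n ≤ 2 ^ ⌈(n : ℝ) ^ ε⌉₊ := by
  obtain ⟨a, c, hQ⟩ := h
  filter_upwards [eventually_linear_scale_pow_le_ceil_rpow a a c p j hε] with n hn
  exact (hQ n).trans (Nat.pow_le_pow_right (by norm_num) hn)

end EBnd

/-! ### From a level-`0` decider to `DTIME` -/

section Packaging

/-- **A level-`0` decider with an eventual time bound `T n n ≤ f n` is a `DTIME(f)` algorithm**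
(the finitely many short lengths are absorbed in the constant of `c · f n + c`,
`exists_const_of_eventually_le`). [cite: AroraBarakCC2009, Def. 1.12 (the `O(·)` in `DTIME`)] -/
theorem DecIn.mem_DTIME_of_eventually_le {L : Language Bool} {T : ℕ → ℕ → ℕ} {f : ℕ → ℕ}
    (h : DecIn 0 L T) (hT : ∀ᶠ n : ℕ in atTop, T n n ≤ f n) : L ∈ DTIME f := by
  obtain ⟨c, hc⟩ := exists_const_of_eventually_le (T := fun n => T n n) hT
  obtain ⟨M, hM⟩ := h
  exact ⟨c, M, fun u => (hM u).mono (hc u.length)⟩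

/-- The fine cost at the top level is `2^{O(m^p)} · poly` when the range is `O(m^p)` and the
matrix time (at the entries' length `2n + 2 + β n`) is. [folklore] -/
theorem EBnd.fineCost {p j a : ℕ} (q : Polynomial ℕ) {β : ℕ → ℕ} {t : ℕ → ℕ → ℕ}
    (hβK : ∃ K, ∀ n, β n ≤ K * (Nat.sqrt^[j] n) ^ p + K)
    (ht : EBnd p j fun n => t n (2 * n + 2 + β n)) :
    EBnd p j fun n => fineCost a q β t n n := by
  obtain ⟨K, hK⟩ := hβK
  have h2 : EBnd p j fun n => 2 ^ (a * (β n + 1)) := by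
    refine EBnd.two_pow (a * K + a) fun n => ?_
    calc a * (β n + 1) ≤ a * (K * (Nat.sqrt^[j] n) ^ p + K + 1) :=
          Nat.mul_le_mul_left a (Nat.succ_le_succ (hK n))
      _ = a * K * (Nat.sqrt^[j] n) ^ p + (a * K + a) := by ring
      _ ≤ (a * K + a) * (Nat.sqrt^[j] n) ^ p + (a * K + a) :=
          Nat.add_le_add_right (Nat.mul_le_mul_right _ (Nat.le_add_right _ _)) _
  exact (h2.mul (EBnd.poly q EBnd.self)).mul (ht.add (EBnd.const 1))

/-- **Bounded majority within `DTIME(2^{n^ε})`.** If `A` is decided one level up within a time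
`t` that is `2^{O(m^p)} · poly(n)` on the entries (`m = Nat.sqrt^[j] n`), over a range
`β n ≤ K m^p + K` with an `FP` producer, then `BMAJ 0 β A ∈ DTIME(2^{n^ε})` for every
`ε > p · 2^{-j}`. [cite: AroraBarakCC2009, Lemma 20.3 (proof: time `2^{O(ℓ(n))}`) and §20.1]
[cite: ImpagliazzoWigderson2001, §2.1 (time `2^{O(n^c)} = O(2^{k^δ})`)] -/
theorem DecIn.bmajFine_mem_DTIME_ceil_rpow {β : ℕ → ℕ} {A : Language Bool} {t : ℕ → ℕ → ℕ}
    {p j : ℕ} (hA : DecIn 1 A t) (hβ : FPProducer β)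
    (hβK : ∃ K, ∀ n, β n ≤ K * (Nat.sqrt^[j] n) ^ p + K)
    (ht : EBnd p j fun n => t n (2 * n + 2 + β n)) {ε : ℝ} (hε : p * (1 / 2 : ℝ) ^ j < ε) :
    BMAJ 0 β A ∈ DTIME fun n => 2 ^ ⌈(n : ℝ) ^ ε⌉₊ := by
  obtain ⟨a, q, hdec⟩ := hA.bmajFine hβ
  exact hdec.mem_DTIME_of_eventually_le
    ((EBnd.fineCost q hβK ht).eventually_le_two_pow_ceil_rpow hε)

/-- **Bounded existential quantifier within `DTIME(2^{n^ε})`** (same hypotheses).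
[cite: AroraBarakCC2009, §2.1 (exhaustive search) and §20.1] -/
theorem DecIn.bexFine_mem_DTIME_ceil_rpow {β : ℕ → ℕ} {A : Language Bool} {t : ℕ → ℕ → ℕ}
    {p j : ℕ} (hA : DecIn 1 A t) (hβ : FPProducer β)
    (hβK : ∃ K, ∀ n, β n ≤ K * (Nat.sqrt^[j] n) ^ p + K)
    (ht : EBnd p j fun n => t n (2 * n + 2 + β n)) {ε : ℝ} (hε : p * (1 / 2 : ℝ) ^ j < ε) :
    BEX 0 β A ∈ DTIME fun n => 2 ^ ⌈(n : ℝ) ^ ε⌉₊ := by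
  obtain ⟨a, q, hdec⟩ := hA.bexFine hβ
  exact hdec.mem_DTIME_of_eventually_le
    ((EBnd.fineCost q hβK ht).eventually_le_two_pow_ceil_rpow hε)

end Packaging

end NKannan

/-! ### The majority-vote simulation of Impagliazzo–Wigderson 1998, §2.1, in `DTIME[2^{n^ε}]` -/

namespace IWUniform

open Filter

variable (L' : Language Bool) (g : ℕ → List Bool → List Bool)

/-- **The matrix of the simulation**: the pairs `⟨x, s⟩` whose seed `s`, expanded by the
generator at the input length, passes the witness test — `{⟨x, s⟩ | ⟨x, g_{|x|}(s)⟩ ∈ L'}`.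
[cite: ImpagliazzoWigderson2001, §2.1 ("simulate the BPP algorithm on each element of the range")] -/
def matrix : Language Bool :=
  {w | boolPair (fstP w) (g (fstP w).length (sndP w)) ∈ L'}

variable {L' g}

/-- Membership of a pair in the matrix. [folklore] -/
@[simp] theorem boolPair_mem_matrix (x s : List Bool) :
    boolPair x s ∈ matrix L' g ↔ boolPair x (g x.length s) ∈ L' := by
  show boolPair (fstP (boolPair x s)) (g (fstP (boolPair x s)).length (sndP (boolPair x s))) ∈ L' ↔ _
  rw [fstP_boolPair, sndP_boolPair]

variable (L' g)

/-- **The majority-vote simulation is a bounded majority quantifier over the matrix**: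
`majSim L' g k = BMAJ 0 k (matrix L' g)`. [cite: ImpagliazzoWigderson2001, §2.1] -/
theorem majSim_eq_BMAJ (k : ℕ → ℕ) : majSim L' g k = NKannan.BMAJ 0 k (matrix L' g) := by
  ext x
  rw [mem_majSim_iff, NKannan.mem_BMAJ_iff, Function.iterate_zero, id_eq, vote]
  simp only [boolPair_mem_matrix]

variable {L' g}

/-- **`B ∈ DTIME[2^{n^ε}]`** (van Melkebeek Thm. 6.2.1; IW §2.1: "we construct the range of `G_n`
… in time `2^{O(n^c)} = O(2^{k^δ})` … simulate the `BPP` algorithm on each element of the range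
and take the majority vote"): if the matrix `{⟨x, s⟩ | ⟨x, g_{|x|}(s)⟩ ∈ L'}` is decided within a
time that is `2^{O(m^p)} · poly` on the entries (`m = ⌊n^{2^{-j}}⌋`, the scale a machine
computes), and the seed length `k n ≤ K m^p + K` has an `FP` producer, then the majority-vote
simulation `majSim L' g k` lies in `DTIME (fun n => 2 ^ ⌈(n : ℝ) ^ ε⌉₊)` for every
`ε > p · 2^{-j}`. [cite: ImpagliazzoWigderson2001, §2.1] [cite: VanMelkebeek2000, Thm. 6.2.1 (p. 142)] -/
theorem majSim_mem_DTIME_ceil_rpow {k : ℕ → ℕ} {t : ℕ → ℕ → ℕ} {p j : ℕ}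
    (hM : NKannan.DecIn 1 (matrix L' g) t) (hk : NKannan.FPProducer k)
    (hkK : ∃ K, ∀ n, k n ≤ K * (Nat.sqrt^[j] n) ^ p + K)
    (ht : NKannan.EBnd p j fun n => t n (2 * n + 2 + k n)) {ε : ℝ} (hε : p * (1 / 2 : ℝ) ^ j < ε) :
    majSim L' g k ∈ DTIME fun n => 2 ^ ⌈(n : ℝ) ^ ε⌉₊ := by
  rw [majSim_eq_BMAJ]
  exact hM.bmajFine_mem_DTIME_ceil_rpow hk hkK ht hε

end IWUniform

end Literature.Computability.Complexity

end
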